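import Literature.NumberTheory.Automorphic.ArchWhittakerCasimirEigendistribution
import Literature.NumberTheory.Automorphic.ArchGKSymmetryReduction
import HarnessLib

/-!
# The place Casimir operators on `C_c^∞(GL_n(K_∞))` are bi-invariant and commute with the
# Gelfand–Kazhdan involution; (GK_∞^𝔷) from the vanishing theorem for Casimir eigendistributions

Topic `NumberTheory/Automorphic`; namespace `Literature.NumberTheory.Automorphic`. Theorems and the
right-derivative linear maps of the test space; no named fact. Continuing
`ArchWhittakerCasimirEigendistribution` (multiplicity one for `GL_n` from the `ι`-symmetry (GK_∞^𝔷) of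
bi-`ψ_∞`-quasi-invariant Casimir eigendistributions), this file proves:

* §1–2 `L_X f (g) = -(R_{g⁻¹ X g} f)(g)` and the expansion of the left letters `L_{E_{ij} ⊗ r_w}`,
  `L^{hol}_{ij}`, `L^{anti}_{ij}` at a point `g` in the right letters with the coefficients of `Ad(g⁻¹)`;
* §3 **the place Casimir operators are bi-invariant**: `Σ_{ij} L_{ij} L_{ji} f = Σ_{ij} R_{ij} R_{ji} f`
  (`placeCasimirReal_eq_right`, `placeCasimirHol_eq_right`, `placeCasimirAnti_eq_right`): expand the outer
  left letter at `g`, commute left and right letters (`archLeftDeriv_archRightDeriv_comm`), expand again,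
  and contract with `g⁻¹ g = 1` (Knapp (1986), Ch. VIII §3: the Casimir element is `Ad(G)`-invariant);
* §4 **`Ω (f ∘ ι) = (Ω f) ∘ ι`** for `ι(g) = w⁰ ᵗg w⁰` (`L_X (f ∘ ι) = (R_{-X♯} f) ∘ ι`,
  `(E_{ij} ⊗ c)♯ = E_{rev j, rev i} ⊗ c`, and §3), hence `T - T ∘ ι` is a Casimir eigendistribution when
  `T` is (`IsArchCasimirEigendistribution.sub_comp_compGKInvolution`);
* §5 **(GK_∞^𝔷) from the VANISHING THEOREM (VT^𝔷)**
  (`archBiWhittaker_gkInvolution_stable_of_casimirSmallCellVanishing`): if every `ι`-odd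
  bi-`ψ_∞`-quasi-invariant Casimir eigendistribution vanishing on the test functions supported in the big
  cell `N w⁰ B` is zero, then every bi-`ψ_∞`-quasi-invariant Casimir eigendistribution is `ι`-symmetric
  (apply (VT^𝔷) to `T - T ∘ ι`, which kills the big-cell functions by the PROVED easy half
  `archBiWhittaker_gkInvolution_stable_of_tsupport_subset_bigCell`), and
  **`multiplicity_one_gl_of_casimirSmallCellVanishing : (VT^𝔷) → multiplicity_one_gl n K μ`**.

(VT^𝔷) is Shalika's archimedean Proposition 6 (announced for Casimir eigendistributions, Shalika (1973),
footnote 5) minus its easy half; it is kept as the explicit hypothesis `hVT` and is NOT proved here.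

## References

* J. A. Shalika, *On the multiplicity of the spectrum of the space of cusp forms of `GL_n`*, Bull. AMS 79
  (1973), §5, Prop. 6 and footnote 5 (p. 460) [Shalika1973].
* J. A. Shalika, *The multiplicity one theorem for `GL_n`*, Ann. of Math. 100 (1974), §2 [Shalika1974].
* A. W. Knapp, *Representation Theory of Semisimple Groups* (1986), Ch. VIII §3 [Knapp1986].
-/

noncomputable section

open MeasureTheory Measure NumberField NumberField.mixedEmbedding NumberField.InfinitePlace IsDedekindDomain Set Filter
open scoped MatrixGroups Topology Classical ContDiff Matrix.Norms.Operator ComplexConjugate InnerProductSpace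

namespace Literature.NumberTheory.Automorphic

variable {n : ℕ} {K : Type} [Field K] [NumberField K]

attribute [local instance] glInfBorel borelSpace_glInf locallyCompactSpace_glInf
  secondCountableTopology_glInf

-- Mathlib idiom (Mathlib/Algebra/Lie/OfAssociative.lean): the commutator Lie ring on matrices
attribute [local instance 100] LieRing.ofAssociativeRing

-- as in `ArchGardingWhittaker`: the scoped `L∞`-operator normed ring structure on matrices is only
-- reducibly defeq to the Pi uniformity
set_option backward.isDefEq.respectTransparency false

local notation "Mat" => Matrix (Fin n) (Fin n) (mixedSpace K)
local notation "G∞" => GL (Fin n) (mixedSpace K)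
local notation "R∞" => mixedSpace K

/-! ### 0. Two contractions of finite sums -/

section Contract

/-- `Σ_j b_{jl} Σ_{k'} a_{k'j} Y_{k'} = Y_l` when `Σ_j a_{k'j} b_{jl} = δ_{k'l}`. [folklore] -/
theorem sum_mul_sum_contract_right {m : ℕ} (a b : Fin m → Fin m → ℂ)
    (hab : ∀ k l, ∑ i, a k i * b i l = if k = l then 1 else 0) (l : Fin m) (Y : Fin m → ℂ) :
    ∑ j, b j l * ∑ k', a k' j * Y k' = Y l := by
  calc ∑ j, b j l * ∑ k', a k' j * Y k' = ∑ j, ∑ k', a k' j * b j l * Y k' := by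
        refine Finset.sum_congr rfl fun j _ => ?_
        rw [Finset.mul_sum]
        exact Finset.sum_congr rfl fun k' _ => by ring
    _ = ∑ k', (∑ j, a k' j * b j l) * Y k' := by
        rw [Finset.sum_comm]
        exact Finset.sum_congr rfl fun k' _ => by rw [Finset.sum_mul]
    _ = ∑ k', (if k' = l then 1 else 0) * Y k' := Finset.sum_congr rfl fun k' _ => by rw [hab]
    _ = Y l := by simp [ite_mul]

/-- `Σ_i a_{ki} Σ_{l'} b_{il'} X_{l'} = X_k` when `Σ_i a_{ki} b_{il'} = δ_{kl'}`. [folklore] -/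
theorem sum_mul_sum_contract_left {m : ℕ} (a b : Fin m → Fin m → ℂ)
    (hab : ∀ k l, ∑ i, a k i * b i l = if k = l then 1 else 0) (k : Fin m) (X : Fin m → ℂ) :
    ∑ i, a k i * ∑ l', b i l' * X l' = X k := by
  calc ∑ i, a k i * ∑ l', b i l' * X l' = ∑ i, ∑ l', a k i * b i l' * X l' := by
        refine Finset.sum_congr rfl fun i _ => ?_
        rw [Finset.mul_sum]
        exact Finset.sum_congr rfl fun l' _ => by ring
    _ = ∑ l', (∑ i, a k i * b i l') * X l' := by
        rw [Finset.sum_comm]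
        exact Finset.sum_congr rfl fun l' _ => by rw [Finset.sum_mul]
    _ = ∑ l', (if k = l' then 1 else 0) * X l' := Finset.sum_congr rfl fun l' _ => by rw [hab]
    _ = X k := by simp [ite_mul]

/-- **The Casimir double sum is insensitive to replacing left letters by right letters**: if operators
`A_{ij}` expand at a point (through `ev`) as `ev (A_{ij} F) = -Σ_{kl} a_{ki} b_{jl} ev (B_{kl} F)` with
`Σ_i a_{ki} b_{il} = δ_{kl}`, and the `A`'s commute with the `B`'s, then
`ev (Σ_{ij} A_{ij} A_{ji} f) = ev (Σ_{ij} B_{ij} B_{ji} f)` (the `Ad(G)`-invariance of the Casimir element,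
Knapp (1986), Ch. VIII §3, in coordinates). [cite: Knapp1986, Ch. VIII §3] -/
theorem apply_sum_sum_comp_eq_of_expansion {m : ℕ} {V : Type*} [AddCommGroup V] [Module ℂ V]
    (A B : Fin m → Fin m → V →ₗ[ℂ] V) (ev : V →ₗ[ℂ] ℂ) (a b : Fin m → Fin m → ℂ)
    (hexp : ∀ (i j : Fin m) (F : V), ev (A i j F) = -∑ k, ∑ l, (a k i * b j l) * ev (B k l F))
    (hcomm : ∀ i j k l : Fin m, A i j ∘ₗ B k l = B k l ∘ₗ A i j)
    (hab : ∀ k l, ∑ i, a k i * b i l = if k = l then 1 else 0) (f : V) :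
    ev ((∑ i, ∑ j, A i j ∘ₗ A j i) f) = ev ((∑ i, ∑ j, B i j ∘ₗ B j i) f) := by
  simp only [LinearMap.sum_apply, LinearMap.comp_apply, _root_.map_sum]
  set T : Fin m → Fin m → Fin m → Fin m → ℂ := fun k l k' l' => ev (B k' l' (B k l f)) with hT
  -- expand twice
  have h1 : ∀ i j, ev (A i j (A j i f)) =
      ∑ k, ∑ l, (a k i * b j l) * ∑ k', ∑ l', (a k' j * b i l') * T k l k' l' := by
    intro i j
    calc ev (A i j (A j i f)) = -∑ k, ∑ l, (a k i * b j l) * ev (B k l (A j i f)) := hexp i j _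
      _ = -∑ k, ∑ l, (a k i * b j l) * ev (A j i (B k l f)) := by
          congr 1
          refine Finset.sum_congr rfl fun k _ => Finset.sum_congr rfl fun l _ => ?_
          rw [← LinearMap.comp_apply (f := B k l) (g := A j i), ← hcomm j i k l, LinearMap.comp_apply]
      _ = -∑ k, ∑ l, (a k i * b j l) * -∑ k', ∑ l', (a k' j * b i l') * T k l k' l' := by
          congr 1
          refine Finset.sum_congr rfl fun k _ => Finset.sum_congr rfl fun l _ => ?_
          rw [hexp j i]
      _ = ∑ k, ∑ l, (a k i * b j l) * ∑ k', ∑ l', (a k' j * b i l') * T k l k' l' := by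
          rw [← Finset.sum_neg_distrib]
          refine Finset.sum_congr rfl fun k _ => ?_
          rw [← Finset.sum_neg_distrib]
          refine Finset.sum_congr rfl fun l _ => ?_
          rw [mul_neg, neg_neg]
  rw [Finset.sum_congr rfl fun i _ => Finset.sum_congr rfl fun j _ => h1 i j]
  -- contract `j`: move it inside `k, l`
  have h2 : ∀ i, (∑ j, ∑ k, ∑ l, (a k i * b j l) * ∑ k', ∑ l', (a k' j * b i l') * T k l k' l') =
      ∑ k, ∑ l, a k i * ∑ l', b i l' * T k l l l' := by
    intro i
    rw [Finset.sum_comm]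
    refine Finset.sum_congr rfl fun k _ => ?_
    rw [Finset.sum_comm]
    refine Finset.sum_congr rfl fun l _ => ?_
    have h3 : ∀ j, (a k i * b j l) * ∑ k', ∑ l', (a k' j * b i l') * T k l k' l' =
        a k i * (b j l * ∑ k', a k' j * ∑ l', b i l' * T k l k' l') := by
      intro j
      rw [mul_assoc]
      congr 1
      congr 1
      refine Finset.sum_congr rfl fun k' _ => ?_
      rw [Finset.mul_sum]
      exact Finset.sum_congr rfl fun l' _ => by ring
    rw [Finset.sum_congr rfl fun j _ => h3 j, ← Finset.mul_sum, sum_mul_sum_contract_right a b hab l (fun k' => ∑ l', b i l' * T k l k' l')]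
  rw [Finset.sum_congr rfl fun i _ => h2 i]
  -- contract `i`: move it inside `k, l`
  rw [Finset.sum_comm]
  have h4 : ∀ k, (∑ i, ∑ l, a k i * ∑ l', b i l' * T k l l l') = ∑ l, T k l l k := by
    intro k
    rw [Finset.sum_comm]
    exact Finset.sum_congr rfl fun l _ => sum_mul_sum_contract_left a b hab k (fun l' => T k l l l')
  rw [Finset.sum_congr rfl fun k _ => h4 k, Finset.sum_comm]

end Contract

/-! ### 1. Right derivatives on the test space; `L_X f (g) = -(R_{g⁻¹ X g} f)(g)` -/

namespace archTestFunctions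

/-- **The right derivative `R_X` as a linear map of the test space `C_c^∞(G_∞)`**
(`IsArchTestFunction.archRightDeriv`, `archRightDeriv_add`, `archRightDeriv_smul`). [folklore] -/
def rightDeriv (X : Mat) : ↥(archTestFunctions n K) →ₗ[ℂ] ↥(archTestFunctions n K) where
  toFun f := ⟨archRightDeriv X (f : G∞ → ℂ), f.2.archRightDeriv X⟩
  map_add' f g := by
    refine Subtype.ext ?_
    change archRightDeriv X ((f : G∞ → ℂ) + (g : G∞ → ℂ)) = archRightDeriv X (f : G∞ → ℂ) + archRightDeriv X (g : G∞ → ℂ)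
    exact f.2.archRightDeriv_add g.2 X
  map_smul' c f := by
    refine Subtype.ext ?_
    change archRightDeriv X (c • (f : G∞ → ℂ)) = c • archRightDeriv X (f : G∞ → ℂ)
    exact archRightDeriv_smul c X (f : G∞ → ℂ)

/-- Unfolding of `rightDeriv`. [folklore] -/
@[simp] theorem rightDeriv_apply (X : Mat) (f : ↥(archTestFunctions n K)) :
    ((rightDeriv X f : ↥(archTestFunctions n K)) : G∞ → ℂ) = archRightDeriv X (f : G∞ → ℂ) := rfl

/-- **Left and right letters commute** on the test space (`archLeftDeriv_archRightDeriv_comm`). [folklore] -/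
theorem leftDeriv_comp_rightDeriv (X Y : Mat) :
    (leftDeriv X ∘ₗ rightDeriv Y : ↥(archTestFunctions n K) →ₗ[ℂ] ↥(archTestFunctions n K)) =
      rightDeriv Y ∘ₗ leftDeriv X := by
  refine LinearMap.ext fun f => Subtype.ext ?_
  change archLeftDeriv X (archRightDeriv Y (f : G∞ → ℂ)) = archRightDeriv Y (archLeftDeriv X (f : G∞ → ℂ))
  exact archLeftDeriv_archRightDeriv_comm f.2 X Y

/-- The evaluation `f ↦ f(g)` as a linear functional on the test space. [folklore] -/
def evalAt (g : G∞) : ↥(archTestFunctions n K) →ₗ[ℂ] ℂ where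
  toFun f := (f : G∞ → ℂ) g
  map_add' _ _ := rfl
  map_smul' _ _ := rfl

/-- Unfolding of `evalAt`. [folklore] -/
@[simp] theorem evalAt_apply (g : G∞) (f : ↥(archTestFunctions n K)) : evalAt g f = (f : G∞ → ℂ) g := rfl

/-- Two test functions with the same values are equal. [folklore] -/
theorem ext_evalAt {f f' : ↥(archTestFunctions n K)} (h : ∀ g : G∞, evalAt g f = evalAt g f') : f = f' :=
  Subtype.ext (funext h)

/-- The right Casimir operator of a real place on test functions: `Σ_{ij} R_{E_{ij} ⊗ r_w} R_{E_{ji} ⊗ r_w}`.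
[cite: Knapp1986, Ch. VIII §3] -/
def placeCasimirRealR (w : {w : InfinitePlace K // IsReal w}) :
    ↥(archTestFunctions n K) →ₗ[ℂ] ↥(archTestFunctions n K) :=
  ∑ i : Fin n, ∑ j : Fin n,
    rightDeriv (Matrix.single i j ((Pi.single w 1, 0) : mixedSpace K)) ∘ₗ
      rightDeriv (Matrix.single j i ((Pi.single w 1, 0) : mixedSpace K))

/-- The right holomorphic letter `R^{hol}_{ij} = R_{E_{ij} ⊗ c_w} - i R_{E_{ij} ⊗ i c_w}`. [cite: Knapp1986, Ch. VIII §3] -/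
def holDerivR (w : {w : InfinitePlace K // IsComplex w}) (i j : Fin n) :
    ↥(archTestFunctions n K) →ₗ[ℂ] ↥(archTestFunctions n K) :=
  rightDeriv (Matrix.single i j ((0, Pi.single w 1) : mixedSpace K)) -
    Complex.I • rightDeriv (Matrix.single i j ((0, Pi.single w Complex.I) : mixedSpace K))

/-- The right antiholomorphic letter `R^{anti}_{ij} = R_{E_{ij} ⊗ c_w} + i R_{E_{ij} ⊗ i c_w}`. [cite: Knapp1986, Ch. VIII §3] -/
def antiDerivR (w : {w : InfinitePlace K // IsComplex w}) (i j : Fin n) :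
    ↥(archTestFunctions n K) →ₗ[ℂ] ↥(archTestFunctions n K) :=
  rightDeriv (Matrix.single i j ((0, Pi.single w 1) : mixedSpace K)) +
    Complex.I • rightDeriv (Matrix.single i j ((0, Pi.single w Complex.I) : mixedSpace K))

/-- The right holomorphic Casimir operator `Σ_{ij} R^{hol}_{ij} R^{hol}_{ji}`. [cite: Knapp1986, Ch. VIII §3] -/
def placeCasimirHolR (w : {w : InfinitePlace K // IsComplex w}) :
    ↥(archTestFunctions n K) →ₗ[ℂ] ↥(archTestFunctions n K) :=
  ∑ i : Fin n, ∑ j : Fin n, holDerivR w i j ∘ₗ holDerivR w j i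

/-- The right antiholomorphic Casimir operator `Σ_{ij} R^{anti}_{ij} R^{anti}_{ji}`. [cite: Knapp1986, Ch. VIII §3] -/
def placeCasimirAntiR (w : {w : InfinitePlace K // IsComplex w}) :
    ↥(archTestFunctions n K) →ₗ[ℂ] ↥(archTestFunctions n K) :=
  ∑ i : Fin n, ∑ j : Fin n, antiDerivR w i j ∘ₗ antiDerivR w j i

/-- Hol letters (left) commute with hol letters (right). [folklore] -/
theorem holDeriv_comp_holDerivR (w : {w : InfinitePlace K // IsComplex w}) (i j k l : Fin n) :
    (holDeriv w i j ∘ₗ holDerivR w k l : ↥(archTestFunctions n K) →ₗ[ℂ] ↥(archTestFunctions n K)) =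
      holDerivR w k l ∘ₗ holDeriv w i j := by
  unfold holDeriv holDerivR
  simp only [LinearMap.comp_sub, LinearMap.sub_comp, LinearMap.comp_smul, LinearMap.smul_comp, leftDeriv_comp_rightDeriv]
  module

/-- Anti letters (left) commute with anti letters (right). [folklore] -/
theorem antiDeriv_comp_antiDerivR (w : {w : InfinitePlace K // IsComplex w}) (i j k l : Fin n) :
    (antiDeriv w i j ∘ₗ antiDerivR w k l : ↥(archTestFunctions n K) →ₗ[ℂ] ↥(archTestFunctions n K)) =
      antiDerivR w k l ∘ₗ antiDeriv w i j := by
  unfold antiDeriv antiDerivR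
  simp only [LinearMap.comp_add, LinearMap.add_comp, LinearMap.comp_smul, LinearMap.smul_comp, leftDeriv_comp_rightDeriv]
  module

end archTestFunctions

/-- **`(L_X α)(g) = -(R_{g⁻¹ X g} α)(g)`**: `α(exp(-sX) g) = α(g exp(-s g⁻¹ X g))`. [folklore] -/
theorem archLeftDeriv_apply_eq_neg_archRightDeriv_conj (X : Mat) (α : G∞ → ℂ) (g : G∞) :
    archLeftDeriv X α g = -archRightDeriv (((g⁻¹ : G∞) : Mat) * X * (g : Mat)) α g := by
  have h1 : archLeftDeriv X α g = -archRightDeriv X (fun h => α (h * g)) 1 := by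
    unfold archLeftDeriv archRightDeriv
    set φ : ℝ → ℂ := fun t => α (1 * expGL (t • X) * g) with hφ
    have hfun : (fun s : ℝ => α ((expGL (s • X))⁻¹ * g)) = fun s : ℝ => φ (-s) := by
      funext s
      simp only [hφ, one_mul, neg_smul, expGL_neg]
    rw [hfun]
    have h := deriv_comp_neg φ 0
    rw [neg_zero] at h
    exact h
  rw [h1, archRightDeriv_comp_mul_right X α g 1, one_mul]

/-! ### 2. Expansion of the left letters at a point in the right letters -/

section Expansion

/-- `R` of a double real linear combination of directions, on a test function. [folklore] -/
theorem archRightDeriv_sum_sum_smul {α : G∞ → ℂ} (hα : IsArchTestFunction n K α) (c : Fin n → Fin n → ℝ)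
    (X : Fin n → Fin n → Mat) :
    archRightDeriv (∑ k, ∑ l, c k l • X k l) α = ∑ k, ∑ l, (c k l : ℂ) • archRightDeriv (X k l) α := by
  rw [← Fintype.sum_prod_type' (f := fun k l => c k l • X k l), hα.archRightDeriv_sum_smul_left,
    Fintype.sum_prod_type' (f := fun k l => (c k l : ℂ) • archRightDeriv (X k l) α)]

/-- `R` of a double sum `Σ_{kl} (u_{kl} P_{kl} + v_{kl} Q_{kl})` of directions, on a test function. [folklore] -/
theorem archRightDeriv_sum_sum_add_smul {α : G∞ → ℂ} (hα : IsArchTestFunction n K α) (u v : Fin n → Fin n → ℝ)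
    (P Q : Fin n → Fin n → Mat) :
    archRightDeriv (∑ k, ∑ l, (u k l • P k l + v k l • Q k l)) α =
      ∑ k, ∑ l, ((u k l : ℂ) • archRightDeriv (P k l) α + (v k l : ℂ) • archRightDeriv (Q k l) α) := by
  have hsplit : (∑ k, ∑ l, (u k l • P k l + v k l • Q k l)) = (∑ k, ∑ l, u k l • P k l) + ∑ k, ∑ l, v k l • Q k l := by
    simp only [Finset.sum_add_distrib]
  rw [hsplit, hα.archRightDeriv_add_left, archRightDeriv_sum_sum_smul hα, archRightDeriv_sum_sum_smul hα]
  simp only [Finset.sum_add_distrib]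

/-- **Expansion of `L_{E_{ij} ⊗ r_w}` at `g` (real place)**:
`(L_{E_{ij} ⊗ r} F)(g) = -Σ_{kl} (g⁻¹_{ki})_w (g_{jl})_w (R_{E_{kl} ⊗ r} F)(g)`. [cite: Knapp1986, Ch. VIII §3] -/
theorem evalAt_leftDeriv_single_realIdem (w : {w : InfinitePlace K // IsReal w}) (i j : Fin n)
    (F : ↥(archTestFunctions n K)) (g : G∞) :
    archTestFunctions.evalAt g (archTestFunctions.leftDeriv (Matrix.single i j ((Pi.single w 1, 0) : mixedSpace K)) F) =
      -∑ k, ∑ l, ((((g⁻¹ : G∞).val k i).1 w : ℝ) : ℂ) * ((((g : G∞).val j l).1 w : ℝ) : ℂ) *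
        archTestFunctions.evalAt g (archTestFunctions.rightDeriv (Matrix.single k l ((Pi.single w 1, 0) : mixedSpace K)) F) := by
  simp only [archTestFunctions.evalAt_apply, archTestFunctions.leftDeriv_apply, archTestFunctions.rightDeriv_apply]
  rw [archLeftDeriv_apply_eq_neg_archRightDeriv_conj]
  have hconj := conj_single_realIdem w (g⁻¹ : G∞) i j
  rw [inv_inv] at hconj
  change -archRightDeriv ((g⁻¹ : G∞).val * Matrix.single i j ((Pi.single w 1, 0) : mixedSpace K) * (g : G∞).val) (F : G∞ → ℂ) g = _
  rw [hconj, archRightDeriv_sum_sum_smul F.2]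
  simp only [Finset.sum_apply, Pi.smul_apply, smul_eq_mul, Complex.ofReal_mul]

/-- The values of `R_{g⁻¹ (E_{ij} ⊗ c_w) g} F` and `R_{g⁻¹ (E_{ij} ⊗ i c_w) g} F` at `g` in the letters
`R_{E_{kl} ⊗ c_w}`, `R_{E_{kl} ⊗ i c_w}` (complex place). [folklore] -/
theorem archRightDeriv_conj_single_complexIdem_apply (w : {w : InfinitePlace K // IsComplex w}) (i j : Fin n)
    (F : ↥(archTestFunctions n K)) (g : G∞) :
    archRightDeriv ((g⁻¹ : G∞).val * Matrix.single i j ((0, Pi.single w 1) : mixedSpace K) * (g : G∞).val) (F : G∞ → ℂ) g =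
      ∑ k, ∑ l, (((((g⁻¹ : G∞).val k i).2 w * ((g : G∞).val j l).2 w).re : ℂ) *
          archRightDeriv (Matrix.single k l ((0, Pi.single w 1) : mixedSpace K)) (F : G∞ → ℂ) g +
        ((((g⁻¹ : G∞).val k i).2 w * ((g : G∞).val j l).2 w).im : ℂ) *
          archRightDeriv (Matrix.single k l ((0, Pi.single w Complex.I) : mixedSpace K)) (F : G∞ → ℂ) g) ∧
    archRightDeriv ((g⁻¹ : G∞).val * Matrix.single i j ((0, Pi.single w Complex.I) : mixedSpace K) * (g : G∞).val) (F : G∞ → ℂ) g =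
      ∑ k, ∑ l, (((-(((g⁻¹ : G∞).val k i).2 w * ((g : G∞).val j l).2 w).im : ℝ) : ℂ) *
          archRightDeriv (Matrix.single k l ((0, Pi.single w 1) : mixedSpace K)) (F : G∞ → ℂ) g +
        ((((g⁻¹ : G∞).val k i).2 w * ((g : G∞).val j l).2 w).re : ℂ) *
          archRightDeriv (Matrix.single k l ((0, Pi.single w Complex.I) : mixedSpace K)) (F : G∞ → ℂ) g) := by
  have hc := conj_single_complexIdem w (g⁻¹ : G∞) i j
  have hci := conj_single_complexIdemI w (g⁻¹ : G∞) i j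
  rw [inv_inv] at hc hci
  constructor
  · rw [hc, archRightDeriv_sum_sum_add_smul F.2]
    simp only [Finset.sum_apply, Pi.add_apply, Pi.smul_apply, smul_eq_mul]
  · rw [hci, archRightDeriv_sum_sum_add_smul F.2]
    simp only [Finset.sum_apply, Pi.add_apply, Pi.smul_apply, smul_eq_mul]

/-- **Expansion of `L^{hol}_{ij}` at `g` (complex place)**:
`(L^{hol}_{ij} F)(g) = -Σ_{kl} (g⁻¹_{ki})_w (g_{jl})_w (R^{hol}_{kl} F)(g)` — complex coefficients: the
holomorphic letters transform complex-linearly under `Ad`. [cite: Knapp1986, Ch. VIII §3] -/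
theorem evalAt_holDeriv (w : {w : InfinitePlace K // IsComplex w}) (i j : Fin n) (F : ↥(archTestFunctions n K)) (g : G∞) :
    archTestFunctions.evalAt g (archTestFunctions.holDeriv w i j F) =
      -∑ k, ∑ l, (((g⁻¹ : G∞).val k i).2 w * ((g : G∞).val j l).2 w) *
        archTestFunctions.evalAt g (archTestFunctions.holDerivR w k l F) := by
  simp only [archTestFunctions.evalAt_apply, archTestFunctions.holDeriv, archTestFunctions.holDerivR,
    LinearMap.sub_apply, LinearMap.smul_apply, Submodule.coe_sub, Submodule.coe_smul, Pi.sub_apply, Pi.smul_apply,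
    archTestFunctions.leftDeriv_apply, archTestFunctions.rightDeriv_apply, smul_eq_mul]
  rw [archLeftDeriv_apply_eq_neg_archRightDeriv_conj, archLeftDeriv_apply_eq_neg_archRightDeriv_conj]
  obtain ⟨hA, hB⟩ := archRightDeriv_conj_single_complexIdem_apply w i j F g
  change -archRightDeriv ((g⁻¹ : G∞).val * Matrix.single i j ((0, Pi.single w 1) : mixedSpace K) * (g : G∞).val) (F : G∞ → ℂ) g -
      Complex.I * -archRightDeriv ((g⁻¹ : G∞).val * Matrix.single i j ((0, Pi.single w Complex.I) : mixedSpace K) * (g : G∞).val)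
        (F : G∞ → ℂ) g = _
  rw [hA, hB, mul_neg, sub_neg_eq_add, Finset.mul_sum, ← Finset.sum_neg_distrib, ← Finset.sum_add_distrib]
  conv_rhs => rw [← Finset.sum_neg_distrib]
  refine Finset.sum_congr rfl fun k _ => ?_
  rw [Finset.mul_sum, ← Finset.sum_neg_distrib, ← Finset.sum_add_distrib, ← Finset.sum_neg_distrib]
  refine Finset.sum_congr rfl fun l _ => ?_
  set z : ℂ := ((g⁻¹ : G∞).val k i).2 w * ((g : G∞).val j l).2 w with hz
  set Rc := archRightDeriv (Matrix.single k l ((0, Pi.single w 1) : mixedSpace K)) (F : G∞ → ℂ) g with hRc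
  set Ric := archRightDeriv (Matrix.single k l ((0, Pi.single w Complex.I) : mixedSpace K)) (F : G∞ → ℂ) g with hRic
  have h1 : ((z.re : ℂ) + Complex.I * (z.im : ℂ)) = z := by
    apply Complex.ext <;> simp
  have hI : Complex.I * Complex.I = -1 := Complex.I_mul_I
  rw [Complex.ofReal_neg]
  linear_combination (-Rc + Complex.I * Ric) * h1 + (-(z.im : ℂ) * Ric) * hI

/-- **Expansion of `L^{anti}_{ij}` at `g` (complex place)**:
`(L^{anti}_{ij} F)(g) = -Σ_{kl} conj((g⁻¹_{ki})_w (g_{jl})_w) (R^{anti}_{kl} F)(g)`. [cite: Knapp1986, Ch. VIII §3] -/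
theorem evalAt_antiDeriv (w : {w : InfinitePlace K // IsComplex w}) (i j : Fin n) (F : ↥(archTestFunctions n K)) (g : G∞) :
    archTestFunctions.evalAt g (archTestFunctions.antiDeriv w i j F) =
      -∑ k, ∑ l, conj (((g⁻¹ : G∞).val k i).2 w * ((g : G∞).val j l).2 w) *
        archTestFunctions.evalAt g (archTestFunctions.antiDerivR w k l F) := by
  simp only [archTestFunctions.evalAt_apply, archTestFunctions.antiDeriv, archTestFunctions.antiDerivR,
    LinearMap.add_apply, LinearMap.smul_apply, Submodule.coe_add, Submodule.coe_smul, Pi.add_apply, Pi.smul_apply,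
    archTestFunctions.leftDeriv_apply, archTestFunctions.rightDeriv_apply, smul_eq_mul]
  rw [archLeftDeriv_apply_eq_neg_archRightDeriv_conj, archLeftDeriv_apply_eq_neg_archRightDeriv_conj]
  obtain ⟨hA, hB⟩ := archRightDeriv_conj_single_complexIdem_apply w i j F g
  change -archRightDeriv ((g⁻¹ : G∞).val * Matrix.single i j ((0, Pi.single w 1) : mixedSpace K) * (g : G∞).val) (F : G∞ → ℂ) g +
      Complex.I * -archRightDeriv ((g⁻¹ : G∞).val * Matrix.single i j ((0, Pi.single w Complex.I) : mixedSpace K) * (g : G∞).val)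
        (F : G∞ → ℂ) g = _
  rw [hA, hB, mul_neg, ← sub_eq_add_neg, Finset.mul_sum, ← Finset.sum_neg_distrib, ← Finset.sum_sub_distrib]
  conv_rhs => rw [← Finset.sum_neg_distrib]
  refine Finset.sum_congr rfl fun k _ => ?_
  rw [Finset.mul_sum, ← Finset.sum_neg_distrib, ← Finset.sum_sub_distrib, ← Finset.sum_neg_distrib]
  refine Finset.sum_congr rfl fun l _ => ?_
  set z : ℂ := ((g⁻¹ : G∞).val k i).2 w * ((g : G∞).val j l).2 w with hz
  set Rc := archRightDeriv (Matrix.single k l ((0, Pi.single w 1) : mixedSpace K)) (F : G∞ → ℂ) g with hRc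
  set Ric := archRightDeriv (Matrix.single k l ((0, Pi.single w Complex.I) : mixedSpace K)) (F : G∞ → ℂ) g with hRic
  have h1 : ((z.re : ℂ) - Complex.I * (z.im : ℂ)) = conj z := by
    apply Complex.ext <;> simp
  have hI : Complex.I * Complex.I = -1 := Complex.I_mul_I
  rw [Complex.ofReal_neg]
  linear_combination (-Rc - Complex.I * Ric) * h1 + (-(z.im : ℂ) * Ric) * hI

end Expansion

/-! ### 3. The place Casimir operators are bi-invariant: `Σ L L = Σ R R` -/

section BiInvariant

omit [NumberField K] in
/-- `Σ_i (g⁻¹_{ki})_w (g_{il})_w = δ_{kl}` at a real place (cast to `ℂ`). [folklore] -/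
theorem sum_inv_fst_mul_fst_eq (w : {w : InfinitePlace K // IsReal w}) (g : G∞) (k l : Fin n) :
    ∑ i, ((((g⁻¹ : G∞).val k i).1 w : ℝ) : ℂ) * ((((g : G∞).val i l).1 w : ℝ) : ℂ) = if k = l then 1 else 0 := by
  have h := sum_fst_mul_fst_inv_eq w (g⁻¹ : G∞) k l
  rw [inv_inv] at h
  exact h

omit [NumberField K] in
/-- `Σ_i (g⁻¹_{ki})_w (g_{il})_w = δ_{kl}` at a complex place. [folklore] -/
theorem sum_inv_snd_mul_snd_eq (w : {w : InfinitePlace K // IsComplex w}) (g : G∞) (k l : Fin n) :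
    ∑ i, ((g⁻¹ : G∞).val k i).2 w * ((g : G∞).val i l).2 w = if k = l then 1 else 0 := by
  have h := sum_snd_mul_snd_inv_eq w (g⁻¹ : G∞) k l
  rw [inv_inv] at h
  exact h

omit [NumberField K] in
/-- The conjugate form at a complex place. [folklore] -/
theorem sum_conj_inv_snd_mul_snd_eq (w : {w : InfinitePlace K // IsComplex w}) (g : G∞) (k l : Fin n) :
    ∑ i, conj (((g⁻¹ : G∞).val k i).2 w) * conj (((g : G∞).val i l).2 w) = if k = l then 1 else 0 := by
  have h := sum_conj_snd_mul_conj_snd_inv_eq w (g⁻¹ : G∞) k l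
  rw [inv_inv] at h
  exact h

/-- **The Casimir operator of a real place is bi-invariant**: `Σ_{ij} L_{ij} L_{ji} = Σ_{ij} R_{ij} R_{ji}` on
`C_c^∞(GL_n(K_∞))` (the `Ad(G)`-invariance of the Casimir element `Σ_{ij} E_{ij} ⊗ E_{ji}` of `𝔤𝔩_n(K_w)`).
[cite: Knapp1986, Ch. VIII §3] -/
theorem archTestFunctions.placeCasimirReal_eq_right (w : {w : InfinitePlace K // IsReal w}) :
    (archTestFunctions.placeCasimirReal w : ↥(archTestFunctions n K) →ₗ[ℂ] ↥(archTestFunctions n K)) =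
      archTestFunctions.placeCasimirRealR w := by
  refine LinearMap.ext fun f => archTestFunctions.ext_evalAt fun g => ?_
  exact apply_sum_sum_comp_eq_of_expansion
    (fun i j => archTestFunctions.leftDeriv (Matrix.single i j ((Pi.single w 1, 0) : mixedSpace K)))
    (fun i j => archTestFunctions.rightDeriv (Matrix.single i j ((Pi.single w 1, 0) : mixedSpace K)))
    (archTestFunctions.evalAt g)
    (fun k i => ((((g⁻¹ : G∞).val k i).1 w : ℝ) : ℂ)) (fun j l => ((((g : G∞).val j l).1 w : ℝ) : ℂ))
    (fun i j F => evalAt_leftDeriv_single_realIdem w i j F g)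
    (fun i j k l => archTestFunctions.leftDeriv_comp_rightDeriv _ _)
    (fun k l => sum_inv_fst_mul_fst_eq w g k l) f

/-- **The holomorphic Casimir operator of a complex place is bi-invariant**:
`Σ_{ij} L^{hol}_{ij} L^{hol}_{ji} = Σ_{ij} R^{hol}_{ij} R^{hol}_{ji}`. [cite: Knapp1986, Ch. VIII §3] -/
theorem archTestFunctions.placeCasimirHol_eq_right (w : {w : InfinitePlace K // IsComplex w}) :
    (archTestFunctions.placeCasimirHol w : ↥(archTestFunctions n K) →ₗ[ℂ] ↥(archTestFunctions n K)) =
      archTestFunctions.placeCasimirHolR w := by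
  refine LinearMap.ext fun f => archTestFunctions.ext_evalAt fun g => ?_
  exact apply_sum_sum_comp_eq_of_expansion
    (fun i j => archTestFunctions.holDeriv w i j) (fun i j => archTestFunctions.holDerivR w i j)
    (archTestFunctions.evalAt g)
    (fun k i => ((g⁻¹ : G∞).val k i).2 w) (fun j l => ((g : G∞).val j l).2 w)
    (fun i j F => evalAt_holDeriv w i j F g)
    (fun i j k l => archTestFunctions.holDeriv_comp_holDerivR w i j k l)
    (fun k l => sum_inv_snd_mul_snd_eq w g k l) f

/-- **The antiholomorphic Casimir operator of a complex place is bi-invariant**: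
`Σ_{ij} L^{anti}_{ij} L^{anti}_{ji} = Σ_{ij} R^{anti}_{ij} R^{anti}_{ji}`. [cite: Knapp1986, Ch. VIII §3] -/
theorem archTestFunctions.placeCasimirAnti_eq_right (w : {w : InfinitePlace K // IsComplex w}) :
    (archTestFunctions.placeCasimirAnti w : ↥(archTestFunctions n K) →ₗ[ℂ] ↥(archTestFunctions n K)) =
      archTestFunctions.placeCasimirAntiR w := by
  refine LinearMap.ext fun f => archTestFunctions.ext_evalAt fun g => ?_
  exact apply_sum_sum_comp_eq_of_expansion
    (fun i j => archTestFunctions.antiDeriv w i j) (fun i j => archTestFunctions.antiDerivR w i j)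
    (archTestFunctions.evalAt g)
    (fun k i => conj (((g⁻¹ : G∞).val k i).2 w)) (fun j l => conj (((g : G∞).val j l).2 w))
    (fun i j F => by rw [evalAt_antiDeriv]; simp only [map_mul])
    (fun i j k l => archTestFunctions.antiDeriv_comp_antiDerivR w i j k l)
    (fun k l => sum_conj_inv_snd_mul_snd_eq w g k l) f

end BiInvariant

/-! ### 4. The Casimir operators commute with `f ↦ f ∘ ι` -/

section Involution

/-- `R_{-Y} F = -R_Y F` for a test function. [folklore] -/
theorem archRightDeriv_neg_dir {F : G∞ → ℂ} (hF : IsArchTestFunction n K F) (Y : Mat) :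
    archRightDeriv (-Y) F = -archRightDeriv Y F := by
  rw [show -Y = (-1 : ℝ) • Y by rw [neg_smul, one_smul], hF.archRightDeriv_smul_left]
  simp

/-- `R_X (-F) = -R_X F`. [folklore] -/
theorem archRightDeriv_neg_fun (X : Mat) (F : G∞ → ℂ) : archRightDeriv X (-F) = -archRightDeriv X F := by
  have h := archRightDeriv_smul (-1 : ℂ) X F
  simpa using h

/-- **`L_X L_Y (f ∘ ι) = (R_{X♯} R_{Y♯} f) ∘ ι`** for a test function `f` (two letters of
`archLeftWordDeriv_comp_gkInvolution`, the signs cancelling). [folklore] -/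
theorem leftDeriv_leftDeriv_compGKInvolution_apply (X Y : Mat) (f : ↥(archTestFunctions n K)) (h : G∞) :
    ((archTestFunctions.leftDeriv X (archTestFunctions.leftDeriv Y (archTestFunctions.compGKInvolution f)) :
        ↥(archTestFunctions n K)) : G∞ → ℂ) h =
      ((archTestFunctions.rightDeriv (weylSharp X) (archTestFunctions.rightDeriv (weylSharp Y) f) :
        ↥(archTestFunctions n K)) : G∞ → ℂ) (gkInvolution h) := by
  have hw := archLeftWordDeriv_comp_gkInvolution (f : G∞ → ℂ) [X, Y]
  simp only [archLeftWordDeriv_cons, archLeftWordDeriv_nil, List.map_cons, List.map_nil, archRightWordDeriv_cons,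
    archRightWordDeriv_nil] at hw
  have hw' := congrFun hw h
  simp only [archTestFunctions.leftDeriv_apply, archTestFunctions.rightDeriv_apply]
  change archLeftDeriv X (archLeftDeriv Y fun g => (f : G∞ → ℂ) (gkInvolution g)) h = _
  rw [hw', archRightDeriv_neg_dir f.2, archRightDeriv_neg_fun, archRightDeriv_neg_dir (f.2.archRightDeriv _)]
  simp

/-- Reindexing a double sum over `Fin n × Fin n` by `(i, j) ↦ (rev j, rev i)`. [folklore] -/
theorem sum_sum_rev_rev {M : Type*} [AddCommMonoid M] (F : Fin n → Fin n → M) :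
    ∑ i : Fin n, ∑ j : Fin n, F j.rev i.rev = ∑ i : Fin n, ∑ j : Fin n, F i j := by
  rw [Finset.sum_comm]
  calc ∑ j : Fin n, ∑ i : Fin n, F j.rev i.rev = ∑ j : Fin n, ∑ i : Fin n, F j i.rev :=
        Equiv.sum_comp Fin.revPerm (fun j => ∑ i : Fin n, F j i.rev)
    _ = ∑ j : Fin n, ∑ i : Fin n, F j i :=
        Finset.sum_congr rfl fun j _ => Equiv.sum_comp Fin.revPerm (fun i => F j i)

/-- **`Ω_w (f ∘ ι) = (Ω_w f) ∘ ι`** for the Casimir operator of a real place: with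
`(E_{ij} ⊗ r)♯ = E_{rev j, rev i} ⊗ r`, `Σ_{ij} L_{ij} L_{ji} (f ∘ ι) = (Σ_{ij} R_{ij} R_{ji} f) ∘ ι = (Ω_w f) ∘ ι`
by bi-invariance. [cite: Knapp1986, Ch. VIII §3] -/
theorem archTestFunctions.placeCasimirReal_compGKInvolution (w : {w : InfinitePlace K // IsReal w})
    (f : ↥(archTestFunctions n K)) :
    archTestFunctions.placeCasimirReal w (archTestFunctions.compGKInvolution f) =
      archTestFunctions.compGKInvolution (archTestFunctions.placeCasimirReal w f) := by
  refine Subtype.ext (funext fun h => ?_)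
  rw [archTestFunctions.compGKInvolution_apply]
  conv_rhs => rw [archTestFunctions.placeCasimirReal_eq_right]
  unfold archTestFunctions.placeCasimirReal archTestFunctions.placeCasimirRealR
  simp only [LinearMap.sum_apply, LinearMap.comp_apply, Submodule.coe_sum, Finset.sum_apply]
  set r : mixedSpace K := (Pi.single w 1, 0) with hr
  calc ∑ i : Fin n, ∑ j : Fin n, ((archTestFunctions.leftDeriv (Matrix.single i j r)
          (archTestFunctions.leftDeriv (Matrix.single j i r) (archTestFunctions.compGKInvolution f)) :
            ↥(archTestFunctions n K)) : G∞ → ℂ) h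
        = ∑ i : Fin n, ∑ j : Fin n, ((archTestFunctions.rightDeriv (Matrix.single j.rev i.rev r)
          (archTestFunctions.rightDeriv (Matrix.single i.rev j.rev r) f) : ↥(archTestFunctions n K)) : G∞ → ℂ) (gkInvolution h) :=
          Finset.sum_congr rfl fun i _ => Finset.sum_congr rfl fun j _ => by
            rw [leftDeriv_leftDeriv_compGKInvolution_apply, weylSharp_single, weylSharp_single]
    _ = ∑ i : Fin n, ∑ j : Fin n, ((archTestFunctions.rightDeriv (Matrix.single i j r)
          (archTestFunctions.rightDeriv (Matrix.single j i r) f) : ↥(archTestFunctions n K)) : G∞ → ℂ) (gkInvolution h) :=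
          sum_sum_rev_rev (fun i j => ((archTestFunctions.rightDeriv (Matrix.single i j r)
            (archTestFunctions.rightDeriv (Matrix.single j i r) f) : ↥(archTestFunctions n K)) : G∞ → ℂ) (gkInvolution h))

/-- `L^{hol}_{ij} L^{hol}_{kl} (f ∘ ι) = (R^{hol}_{rev j, rev i} R^{hol}_{rev l, rev k} f) ∘ ι`. [folklore] -/
theorem holDeriv_holDeriv_compGKInvolution_apply (w : {w : InfinitePlace K // IsComplex w}) (i j k l : Fin n)
    (f : ↥(archTestFunctions n K)) (h : G∞) :
    ((archTestFunctions.holDeriv w i j (archTestFunctions.holDeriv w k l (archTestFunctions.compGKInvolution f)) :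
        ↥(archTestFunctions n K)) : G∞ → ℂ) h =
      ((archTestFunctions.holDerivR w j.rev i.rev (archTestFunctions.holDerivR w l.rev k.rev f) :
        ↥(archTestFunctions n K)) : G∞ → ℂ) (gkInvolution h) := by
  simp only [archTestFunctions.holDeriv, archTestFunctions.holDerivR, LinearMap.sub_apply, LinearMap.smul_apply, map_sub,
    map_smul, Submodule.coe_sub, Submodule.coe_smul, Pi.sub_apply, Pi.smul_apply]
  simp only [leftDeriv_leftDeriv_compGKInvolution_apply, weylSharp_single]

/-- `L^{anti}_{ij} L^{anti}_{kl} (f ∘ ι) = (R^{anti}_{rev j, rev i} R^{anti}_{rev l, rev k} f) ∘ ι`. [folklore] -/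
theorem antiDeriv_antiDeriv_compGKInvolution_apply (w : {w : InfinitePlace K // IsComplex w}) (i j k l : Fin n)
    (f : ↥(archTestFunctions n K)) (h : G∞) :
    ((archTestFunctions.antiDeriv w i j (archTestFunctions.antiDeriv w k l (archTestFunctions.compGKInvolution f)) :
        ↥(archTestFunctions n K)) : G∞ → ℂ) h =
      ((archTestFunctions.antiDerivR w j.rev i.rev (archTestFunctions.antiDerivR w l.rev k.rev f) :
        ↥(archTestFunctions n K)) : G∞ → ℂ) (gkInvolution h) := by
  simp only [archTestFunctions.antiDeriv, archTestFunctions.antiDerivR, LinearMap.add_apply, LinearMap.smul_apply, map_add,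
    map_smul, Submodule.coe_add, Submodule.coe_smul, Pi.add_apply, Pi.smul_apply]
  simp only [leftDeriv_leftDeriv_compGKInvolution_apply, weylSharp_single]

/-- **`Ω^{hol}_w (f ∘ ι) = (Ω^{hol}_w f) ∘ ι`** for the holomorphic Casimir operator of a complex place.
[cite: Knapp1986, Ch. VIII §3] -/
theorem archTestFunctions.placeCasimirHol_compGKInvolution (w : {w : InfinitePlace K // IsComplex w})
    (f : ↥(archTestFunctions n K)) :
    archTestFunctions.placeCasimirHol w (archTestFunctions.compGKInvolution f) =
      archTestFunctions.compGKInvolution (archTestFunctions.placeCasimirHol w f) := by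
  refine Subtype.ext (funext fun h => ?_)
  rw [archTestFunctions.compGKInvolution_apply]
  conv_rhs => rw [archTestFunctions.placeCasimirHol_eq_right]
  unfold archTestFunctions.placeCasimirHol archTestFunctions.placeCasimirHolR
  simp only [LinearMap.sum_apply, LinearMap.comp_apply, Submodule.coe_sum, Finset.sum_apply]
  calc ∑ i : Fin n, ∑ j : Fin n, ((archTestFunctions.holDeriv w i j
          (archTestFunctions.holDeriv w j i (archTestFunctions.compGKInvolution f)) : ↥(archTestFunctions n K)) : G∞ → ℂ) h
        = ∑ i : Fin n, ∑ j : Fin n, ((archTestFunctions.holDerivR w j.rev i.rev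
          (archTestFunctions.holDerivR w i.rev j.rev f) : ↥(archTestFunctions n K)) : G∞ → ℂ) (gkInvolution h) :=
          Finset.sum_congr rfl fun i _ => Finset.sum_congr rfl fun j _ => holDeriv_holDeriv_compGKInvolution_apply w i j j i f h
    _ = ∑ i : Fin n, ∑ j : Fin n, ((archTestFunctions.holDerivR w i j
          (archTestFunctions.holDerivR w j i f) : ↥(archTestFunctions n K)) : G∞ → ℂ) (gkInvolution h) :=
          sum_sum_rev_rev (fun i j => ((archTestFunctions.holDerivR w i j
            (archTestFunctions.holDerivR w j i f) : ↥(archTestFunctions n K)) : G∞ → ℂ) (gkInvolution h))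

/-- **`Ω^{anti}_w (f ∘ ι) = (Ω^{anti}_w f) ∘ ι`** for the antiholomorphic Casimir operator of a complex place.
[cite: Knapp1986, Ch. VIII §3] -/
theorem archTestFunctions.placeCasimirAnti_compGKInvolution (w : {w : InfinitePlace K // IsComplex w})
    (f : ↥(archTestFunctions n K)) :
    archTestFunctions.placeCasimirAnti w (archTestFunctions.compGKInvolution f) =
      archTestFunctions.compGKInvolution (archTestFunctions.placeCasimirAnti w f) := by
  refine Subtype.ext (funext fun h => ?_)
  rw [archTestFunctions.compGKInvolution_apply]
  conv_rhs => rw [archTestFunctions.placeCasimirAnti_eq_right]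
  unfold archTestFunctions.placeCasimirAnti archTestFunctions.placeCasimirAntiR
  simp only [LinearMap.sum_apply, LinearMap.comp_apply, Submodule.coe_sum, Finset.sum_apply]
  calc ∑ i : Fin n, ∑ j : Fin n, ((archTestFunctions.antiDeriv w i j
          (archTestFunctions.antiDeriv w j i (archTestFunctions.compGKInvolution f)) : ↥(archTestFunctions n K)) : G∞ → ℂ) h
        = ∑ i : Fin n, ∑ j : Fin n, ((archTestFunctions.antiDerivR w j.rev i.rev
          (archTestFunctions.antiDerivR w i.rev j.rev f) : ↥(archTestFunctions n K)) : G∞ → ℂ) (gkInvolution h) :=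
          Finset.sum_congr rfl fun i _ => Finset.sum_congr rfl fun j _ => antiDeriv_antiDeriv_compGKInvolution_apply w i j j i f h
    _ = ∑ i : Fin n, ∑ j : Fin n, ((archTestFunctions.antiDerivR w i j
          (archTestFunctions.antiDerivR w j i f) : ↥(archTestFunctions n K)) : G∞ → ℂ) (gkInvolution h) :=
          sum_sum_rev_rev (fun i j => ((archTestFunctions.antiDerivR w i j
            (archTestFunctions.antiDerivR w j i f) : ↥(archTestFunctions n K)) : G∞ → ℂ) (gkInvolution h))

/-- **`T - T ∘ ι` is a Casimir eigendistribution when `T` is** (with the same eigenvalues, because the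
Casimir operators commute with `f ↦ f ∘ ι`). [cite: Shalika1973, §5, footnote 5 (p. 460)] -/
theorem IsArchCasimirEigendistribution.sub_comp_compGKInvolution {T : ↥(archTestFunctions n K) →ₗ[ℂ] ℂ}
    (hT : IsArchCasimirEigendistribution n K T) :
    IsArchCasimirEigendistribution n K (T - T.comp archTestFunctions.compGKInvolution) := by
  obtain ⟨hR, hH, hA⟩ := hT
  refine ⟨fun w => ?_, fun w => ?_, fun w => ?_⟩
  · obtain ⟨c, hc⟩ := hR w
    refine ⟨c, fun f => ?_⟩
    simp only [LinearMap.sub_apply, LinearMap.comp_apply]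
    rw [← archTestFunctions.placeCasimirReal_compGKInvolution, hc, hc, mul_sub]
  · obtain ⟨c, hc⟩ := hH w
    refine ⟨c, fun f => ?_⟩
    simp only [LinearMap.sub_apply, LinearMap.comp_apply]
    rw [← archTestFunctions.placeCasimirHol_compGKInvolution, hc, hc, mul_sub]
  · obtain ⟨c, hc⟩ := hA w
    refine ⟨c, fun f => ?_⟩
    simp only [LinearMap.sub_apply, LinearMap.comp_apply]
    rw [← archTestFunctions.placeCasimirAnti_compGKInvolution, hc, hc, mul_sub]

end Involution

/-! ### 5. (GK_∞^𝔷) from the vanishing theorem for Casimir eigendistributions; multiplicity one -/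

section Reduction

variable {T : ↥(archTestFunctions n K) →ₗ[ℂ] ℂ}

/-- **(GK_∞^𝔷) from the small-cell vanishing statement for Casimir eigendistributions.** If every `ι`-odd
bi-`ψ_∞`-quasi-invariant Casimir eigendistribution on `GL_n(K_∞)` vanishing on the test functions supported
in the big cell is zero (`hVT`), then every bi-`ψ_∞`-quasi-invariant Casimir eigendistribution is
`ι`-symmetric: apply `hVT` to `D = T - T ∘ ι`, which is a Casimir eigendistribution
(`IsArchCasimirEigendistribution.sub_comp_compGKInvolution`) and kills the big-cell functions by the easy half
`archBiWhittaker_gkInvolution_stable_of_tsupport_subset_bigCell`. [cite: Shalika1973, §5, Prop. 6 and footnote 5 (p. 460)]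
[cite: Shalika1974, §2] -/
theorem archBiWhittaker_gkInvolution_stable_of_casimirSmallCellVanishing
    (hVT : ∀ D : ↥(archTestFunctions n K) →ₗ[ℂ] ℂ, IsArchDistribution n K D →
      (∀ (u : ↥(upperUnitriangular (Fin n) (mixedSpace K))) (f : ↥(archTestFunctions n K)),
        D (archTestFunctions.leftTranslate (u : G∞) f) = archWhittakerChar n K u * D f) →
      (∀ (u : ↥(upperUnitriangular (Fin n) (mixedSpace K))) (f : ↥(archTestFunctions n K)),
        D (archTestFunctions.rightTranslate (u : G∞) f) = (archWhittakerChar n K u)⁻¹ * D f) →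
      IsArchCasimirEigendistribution n K D →
      (∀ f : ↥(archTestFunctions n K), D (archTestFunctions.compGKInvolution f) = -D f) →
      (∀ f : ↥(archTestFunctions n K), tsupport (f : G∞ → ℂ) ⊆ {g : G∞ | (g : Mat) ∈ bruhatBigCell n R∞} → D f = 0) →
      ∀ f : ↥(archTestFunctions n K), D f = 0)
    (hT : IsArchDistribution n K T)
    (hL : ∀ (u : ↥(upperUnitriangular (Fin n) (mixedSpace K))) (f : ↥(archTestFunctions n K)),
      T (archTestFunctions.leftTranslate (u : G∞) f) = archWhittakerChar n K u * T f)
    (hR : ∀ (u : ↥(upperUnitriangular (Fin n) (mixedSpace K))) (f : ↥(archTestFunctions n K)),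
      T (archTestFunctions.rightTranslate (u : G∞) f) = (archWhittakerChar n K u)⁻¹ * T f)
    (hC : IsArchCasimirEigendistribution n K T)
    (f : ↥(archTestFunctions n K)) : T (archTestFunctions.compGKInvolution f) = T f := by
  set D : ↥(archTestFunctions n K) →ₗ[ℂ] ℂ := T - T.comp archTestFunctions.compGKInvolution with hD
  -- the element `v = ι(u⁻¹) ∈ N` through which the translations pass to the other side
  set vι : ↥(upperUnitriangular (Fin n) (mixedSpace K)) → ↥(upperUnitriangular (Fin n) (mixedSpace K)) := fun u =>
    ⟨gkInvolution ((u : G∞)⁻¹), gkInvolution_mem_upperUnitriangular (Subgroup.inv_mem _ u.2)⟩ with hvι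
  have hιL : ∀ (u : ↥(upperUnitriangular (Fin n) (mixedSpace K))) (f : ↥(archTestFunctions n K)),
      archTestFunctions.compGKInvolution (archTestFunctions.leftTranslate (u : G∞) f) =
        archTestFunctions.rightTranslate (vι u : G∞) (archTestFunctions.compGKInvolution f) := by
    intro u f
    apply Subtype.ext
    funext x
    simp only [archTestFunctions.compGKInvolution_apply, archTestFunctions.leftTranslate_apply,
      archTestFunctions.rightTranslate_apply, hvι]
    rw [gkInvolution_mul, gkInvolution_gkInvolution]
  have hιR : ∀ (u : ↥(upperUnitriangular (Fin n) (mixedSpace K))) (f : ↥(archTestFunctions n K)),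
      archTestFunctions.compGKInvolution (archTestFunctions.rightTranslate (u : G∞) f) =
        archTestFunctions.leftTranslate (vι u : G∞) (archTestFunctions.compGKInvolution f) := by
    intro u f
    apply Subtype.ext
    funext x
    simp only [archTestFunctions.compGKInvolution_apply, archTestFunctions.leftTranslate_apply,
      archTestFunctions.rightTranslate_apply, hvι]
    rw [gkInvolution_mul, ← gkInvolution_inv, inv_inv, gkInvolution_gkInvolution]
  -- `ψ(ι(u⁻¹)) = ψ(u)⁻¹`
  have hchar : ∀ u : ↥(upperUnitriangular (Fin n) (mixedSpace K)), archWhittakerChar n K (vι u) = (archWhittakerChar n K u)⁻¹ := by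
    intro u
    have h1 : archWhittakerChar n K (vι u) = archWhittakerChar n K u⁻¹ := by
      rw [hvι]
      exact archWhittakerChar_gkInvolution u⁻¹
    rw [h1, archWhittakerChar_eq_cexp, archWhittakerChar_eq_cexp, superdiagSum_inv, map_neg, ← Complex.exp_neg]
    congr 1
    push_cast
    ring
  -- the hypotheses of (VT^𝔷) for `D`
  have hDdist : IsArchDistribution n K D := by
    intro κ hκ
    obtain ⟨C₁, 𝒮₁, hC₁, hb₁⟩ := hT κ hκ
    obtain ⟨C₂, 𝒮₂, hC₂, hb₂⟩ := isArchDistribution_comp_compGKInvolution T hT κ hκ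
    refine ⟨C₁ + C₂, 𝒮₁ ∪ 𝒮₂, by positivity, fun f hf M hM => ?_⟩
    rw [hD, LinearMap.sub_apply]
    calc ‖T f - (T.comp archTestFunctions.compGKInvolution) f‖ ≤ ‖T f‖ + ‖(T.comp archTestFunctions.compGKInvolution) f‖ :=
          norm_sub_le _ _
      _ ≤ C₁ * M + C₂ * M := add_le_add (hb₁ f hf M fun p hp => hM p (Finset.mem_union_left _ hp))
          (hb₂ f hf M fun p hp => hM p (Finset.mem_union_right _ hp))
      _ = (C₁ + C₂) * M := by ring
  have hDL : ∀ (u : ↥(upperUnitriangular (Fin n) (mixedSpace K))) (f : ↥(archTestFunctions n K)),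
      D (archTestFunctions.leftTranslate (u : G∞) f) = archWhittakerChar n K u * D f := by
    intro u f
    simp only [hD, LinearMap.sub_apply, LinearMap.comp_apply]
    rw [hL, hιL, hR, hchar, inv_inv, mul_sub]
  have hDR : ∀ (u : ↥(upperUnitriangular (Fin n) (mixedSpace K))) (f : ↥(archTestFunctions n K)),
      D (archTestFunctions.rightTranslate (u : G∞) f) = (archWhittakerChar n K u)⁻¹ * D f := by
    intro u f
    simp only [hD, LinearMap.sub_apply, LinearMap.comp_apply]
    rw [hR, hιR, hL, hchar, mul_sub]
  have hDC : IsArchCasimirEigendistribution n K D := hC.sub_comp_compGKInvolution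
  have hDodd : ∀ f : ↥(archTestFunctions n K), D (archTestFunctions.compGKInvolution f) = -D f := by
    intro f
    simp only [hD, LinearMap.sub_apply, LinearMap.comp_apply, archTestFunctions.compGKInvolution_compGKInvolution]
    ring
  have hDbig : ∀ f : ↥(archTestFunctions n K), tsupport (f : G∞ → ℂ) ⊆ {g : G∞ | (g : Mat) ∈ bruhatBigCell n R∞} → D f = 0 := by
    intro f hf
    simp only [hD, LinearMap.sub_apply, LinearMap.comp_apply]
    rw [archBiWhittaker_gkInvolution_stable_of_tsupport_subset_bigCell T hT hL hR f hf, sub_self]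
  have h0 := hVT D hDdist hDL hDR hDC hDodd hDbig f
  simp only [hD, LinearMap.sub_apply, LinearMap.comp_apply] at h0
  linear_combination -h0

end Reduction

section MultiplicityOne

variable (n K) (μ : Measure (AdelicGroupData.gl n K).automorphicQuotient)
  [(AdelicGroupData.gl n K).IsAutomorphicMeasure μ]

/-- **Multiplicity one for `L²_cusp(GL_n(𝔸_K))` from the VANISHING THEOREM (VT^𝔷) for bi-`ψ_∞`-quasi-invariant
Casimir eigendistributions on `GL_n(K_∞)`**: if every `ι`-odd distribution `D` on `G_∞ = GL_n(K_∞)`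
(`IsArchDistribution`) with `D(λ(u) f) = ψ_∞(u) D f`, `D(ρ(u) f) = ψ_∞(u)⁻¹ D f` (`u ∈ N_n(K_∞)`), which is an
eigendistribution of all the place Casimir operators (`IsArchCasimirEigendistribution`) and which vanishes on the
test functions supported in the big cell `N w⁰ B`, is zero — Shalika's archimedean Proposition 6 for Casimir
eigendistributions (Shalika (1973), footnote 5; Shalika (1974), §2) minus its proved easy half — then
multiplicity one holds for the cuspidal spectrum of `GL_n(𝔸_K)` (Shalika (1974), Thm. 5.5). Everything else in
the printed proof is proved in the tree. [cite: Shalika1974, §2 and Thm. 5.5]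
[cite: Shalika1973, §5, Prop. 6 and footnote 5 (p. 460)] -/
theorem multiplicity_one_gl_of_casimirSmallCellVanishing
    (hVT : ∀ D : ↥(archTestFunctions n K) →ₗ[ℂ] ℂ, IsArchDistribution n K D →
      (∀ (u : ↥(upperUnitriangular (Fin n) (mixedSpace K))) (f : ↥(archTestFunctions n K)),
        D (archTestFunctions.leftTranslate (u : GL (Fin n) (mixedSpace K)) f) = archWhittakerChar n K u * D f) →
      (∀ (u : ↥(upperUnitriangular (Fin n) (mixedSpace K))) (f : ↥(archTestFunctions n K)),
        D (archTestFunctions.rightTranslate (u : GL (Fin n) (mixedSpace K)) f) = (archWhittakerChar n K u)⁻¹ * D f) →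
      IsArchCasimirEigendistribution n K D →
      (∀ f : ↥(archTestFunctions n K), D (archTestFunctions.compGKInvolution f) = -D f) →
      (∀ f : ↥(archTestFunctions n K),
        tsupport (f : GL (Fin n) (mixedSpace K) → ℂ) ⊆
          {g : GL (Fin n) (mixedSpace K) | (g : Matrix (Fin n) (Fin n) (mixedSpace K)) ∈ bruhatBigCell n (mixedSpace K)} →
        D f = 0) →
      ∀ f : ↥(archTestFunctions n K), D f = 0) :
    multiplicity_one_gl n K μ :=
  multiplicity_one_gl_of_archBiWhittaker_gkInvolution_stable_of_casimir n K μ fun _ hT hL hR hC f =>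
    archBiWhittaker_gkInvolution_stable_of_casimirSmallCellVanishing hVT hT hL hR hC f

end MultiplicityOne


end Literature.NumberTheory.Automorphic
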